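import Summits.KontsevichZagierPeriods.KontsevichZagierPeriods.Theses.HurwitzMicroSectors
import Summits.KontsevichZagierPeriods.KontsevichZagierPeriods.Theorems.HurwitzMicroSectorsNormalFormPrinciplePiBoxTransfer
import Summits.KontsevichZagierPeriods.KontsevichZagierPeriods.Theorems.HurwitzMicroSectorsNormalFormPrincipleVariants2238
import Summits.KontsevichZagierPeriods.KontsevichZagierPeriods.Theorems.HurwitzMicroSectorsNormalFormPrincipleBoxRigidityDimOne

/-! TTRL-lite variant V2209 of stmt-KontsevichZagierPeriods-3869

Variant V2209 = `stub_boxRigidity` (BoxRigidity: two representations on open unit boxes with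
integrands of KZ's rational shape and equal values are KZ-equivalent) with BOTH dimensions FROZEN,
`fix m := 2; fix m' := 3`. Verdict of the attempt seat: **open** — this file is the exact-strength
certificate, not a proof of the variant. The doubly-frozen family is computed in closed form: for
every pair `(m₀, m₀')`,

  `BoxRigidityAt m₀ m₀' ⟺ BoxVanishing (max m₀ m₀')`   (`boxRigidityAt_iff_boxVanishing`),

where `BoxVanishing K` says that a box-rational representation on `(0,1)ᴷ` of value `0` is a
relation (Conjecture 1 of Kontsevich–Zagier for rational integrands on the `K`-box). The two
directions are the sibling certificate's lemmas (file `…Variants2238`, imported and reused, not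
restated): forward, compare with the zero representation on the other box
(`boxVanishingDim_left/right_of_pair`) and take the larger of the two dimensions
(`boxVanishing_max`, here); backward, pad both representations to the common box `(0,1)^max`
and subtract there (`boxRigidityLe_of_boxVanishingDim`, via the tree's `pad_le` / `sub_same`).
Hence the doubly-frozen variants (`fix_nat:m=a; fix_nat:m'=b`) form ONE CHAIN indexed by
`d = max a b`, monotone in `d` (`boxVanishingDim_mono`; `boxRigidityAt_of_le` here): its bottom
`d ≤ 1` is a theorem (`boxRigidityAt_of_max_le_one`, from `Dlog.boxRigidity_of_le_one`, Baker), every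
level `d ≥ 2` is open, and V2209 is the level `d = 3`:
`V2209 ⟺ BoxVanishing 3 ⟺ BoxRigidity for all m, m' ≤ 3 ⟺ V2238`
(`stub_boxRigidity_var2209_iff_boxVanishing_three`, `…_iff_le_three`, `…_iff_var2238`) — Conjecture 1
for ALL absolutely convergent `∫_{(0,1)³} p/q` (`q ≠ 0` on the open box) against `∫_{(0,1)²} p/q`,
whose instances include `G − qπ² = 0 ⇒ relation` for every `q ∈ ℚ` (irrationality of `G/π²`, open)
and `aζ(3) + bπ³ + c = 0 ⇒ relation` (`ℚ`-independence of `1, ζ(3), π³`, open). It is implied by the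
Summit (`stub_boxRigidity_var2209_of_statement`), so it is not refutable from the tree either.
Source: M. Kontsevich, D. Zagier, *Periods* (2001), §1.2 Conjecture 1; A. Baker, *Transcendental
Number Theory* (1975), Thm. 2.1 (the level `d ≤ 1`). Pure proof file, no definitions. -/

-- `Summit.<Summit>.<Problem>` is the tree's mandated summit-side namespace (CONVENTIONS §2); for this
-- single-conjunct summit the two coincide, so the duplicate is deliberate.
set_option linter.dupNamespace false

noncomputable section

namespace Summit.KontsevichZagierPeriods.KontsevichZagierPeriods.Theorems

open MeasureTheory Set
open Literature.NumberTheory.Transcendental Literature.NumberTheory.Transcendental.KZ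
open Summit.KontsevichZagierPeriods.KontsevichZagierPeriods.Theses.HurwitzMicroSectors
open Summit.KontsevichZagierPeriods.HurwitzMicroSectors.NormalFormPrinciple.PiBox

/-! ## The doubly-frozen leaf in closed form -/

/-- `BoxVanishing a` and `BoxVanishing b` give `BoxVanishing (max a b)` (the maximum is one of the
two). [cite: KontsevichZagier2001, §1.2] -/
theorem boxVanishing_max {a b : ℕ}
    (ha : ∀ N : IntegralRep a, N.domain = {x | ∀ i, x i ∈ Set.Ioo (0:ℝ) 1} → N.IsRational →
      N.value = 0 → of N ∈ relations)
    (hb : ∀ N : IntegralRep b, N.domain = {x | ∀ i, x i ∈ Set.Ioo (0:ℝ) 1} → N.IsRational →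
      N.value = 0 → of N ∈ relations) :
    ∀ N : IntegralRep (max a b), N.domain = {x | ∀ i, x i ∈ Set.Ioo (0:ℝ) 1} → N.IsRational →
      N.value = 0 → of N ∈ relations := by
  obtain h | h := max_choice a b
  · rw [h]; exact ha
  · rw [h]; exact hb

/-- **`BoxRigidityAt m₀ m₀' ⟺ BoxVanishing (max m₀ m₀')`** — rigidity for ONE frozen pair of
dimensions is exactly Conjecture 1 for box-rational periods of the larger dimension: (⇒) vanishing in
both dimensions by comparison with the zero representation on the other box
(`boxVanishingDim_left/right_of_pair`), whence at the maximum; (⇐) pad both representations to the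
`max`-box and subtract there (`boxRigidityLe_of_boxVanishingDim`). So the programmatic moves
`fix_nat:m=m₀; fix_nat:m'=m₀'` of `stub_boxRigidity` produce one chain `BoxVanishing d`,
`d = max m₀ m₀'`. [cite: KontsevichZagier2001, §1.2 Conjecture 1] -/
theorem boxRigidityAt_iff_boxVanishing (m₀ m₀' : ℕ) :
    (∀ (N : IntegralRep m₀) (N' : IntegralRep m₀'),
      N.domain = {x | ∀ i, x i ∈ Set.Ioo (0:ℝ) 1} → N.IsRational →
      N'.domain = {x | ∀ i, x i ∈ Set.Ioo (0:ℝ) 1} → N'.IsRational →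
      N.value = N'.value → Equivalent N N') ↔
    (∀ N : IntegralRep (max m₀ m₀'), N.domain = {x | ∀ i, x i ∈ Set.Ioo (0:ℝ) 1} → N.IsRational →
      N.value = 0 → of N ∈ relations) :=
  ⟨fun hrig => boxVanishing_max (boxVanishingDim_left_of_pair m₀ m₀' hrig)
      (boxVanishingDim_right_of_pair m₀ m₀' hrig),
    fun hvan N N' hNd hNr hN'd hN'r hv => boxRigidityLe_of_boxVanishingDim (max m₀ m₀') hvan m₀ m₀'
      N N' (le_max_left _ _) (le_max_right _ _) hNd hNr hN'd hN'r hv⟩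

/-- **The chain is monotone**: `BoxRigidityAt K K ⇒ BoxRigidityAt m₀ m₀'` whenever `m₀, m₀' ≤ K`
(vanish at `K`, pad, subtract). [cite: KontsevichZagier2001, §1.2 Conjecture 1] -/
theorem boxRigidityAt_of_le {m₀ m₀' K : ℕ} (h : m₀ ≤ K) (h' : m₀' ≤ K)
    (hrig : ∀ (N : IntegralRep K) (N' : IntegralRep K),
      N.domain = {x | ∀ i, x i ∈ Set.Ioo (0:ℝ) 1} → N.IsRational →
      N'.domain = {x | ∀ i, x i ∈ Set.Ioo (0:ℝ) 1} → N'.IsRational →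
      N.value = N'.value → Equivalent N N') :
    ∀ (N : IntegralRep m₀) (N' : IntegralRep m₀'),
      N.domain = {x | ∀ i, x i ∈ Set.Ioo (0:ℝ) 1} → N.IsRational →
      N'.domain = {x | ∀ i, x i ∈ Set.Ioo (0:ℝ) 1} → N'.IsRational →
      N.value = N'.value → Equivalent N N' :=
  fun N N' => boxRigidityLe_of_boxVanishingDim K (boxVanishingDim_right_of_pair K K hrig) m₀ m₀' N N' h h'

/-- **The bottom of the chain is a theorem: `BoxRigidityAt m₀ m₀'` whenever `max m₀ m₀' ≤ 1`**
(levels `d = 0, 1`), from `Dlog.boxRigidity_of_le_one` (Baker); `BoxVanishing 1` itself is the tree's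
`boxVanishing_one` (file `…Variants2337`). [cite: KontsevichZagier2001, §1.2 Conjecture 1] -/
theorem boxRigidityAt_of_max_le_one (m₀ m₀' : ℕ) (h : max m₀ m₀' ≤ 1) :
    ∀ (N : IntegralRep m₀) (N' : IntegralRep m₀'),
      N.domain = {x | ∀ i, x i ∈ Set.Ioo (0:ℝ) 1} → N.IsRational →
      N'.domain = {x | ∀ i, x i ∈ Set.Ioo (0:ℝ) 1} → N'.IsRational →
      N.value = N'.value → Equivalent N N' :=
  Dlog.boxRigidity_of_le_one m₀ m₀' (le_of_max_le_left h) (le_of_max_le_right h)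

/-! ## The variant V2209 itself: level `d = 3` of the chain -/

/-- **V2209 ⟺ `BoxVanishing 3`** (Conjecture 1 of Kontsevich–Zagier for rational integrands on the
open unit `3`-box: value `0` ⇒ relation) — instance `(2, 3)` of `boxRigidityAt_iff_boxVanishing`.
[cite: KontsevichZagier2001, §1.2 Conjecture 1] -/
theorem stub_boxRigidity_var2209_iff_boxVanishing_three :
    (∀ (N : IntegralRep 2) (N' : IntegralRep 3), N.domain = {x | ∀ i, x i ∈ Set.Ioo (0:ℝ) 1} → N.IsRational → N'.domain = {x | ∀ i, x i ∈ Set.Ioo (0:ℝ) 1} → N'.IsRational → N.value = N'.value → Equivalent N N') ↔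
    (∀ N : IntegralRep 3, N.domain = {x | ∀ i, x i ∈ Set.Ioo (0:ℝ) 1} → N.IsRational →
      N.value = 0 → of N ∈ relations) :=
  boxRigidityAt_iff_boxVanishing 2 3

/-- **V2209 ⟺ BoxRigidity for all dimensions `m, m' ≤ 3`** (the honest strength of the variant: the
whole leaf up to dimension three on both sides — a genuine fragment of the parent, unlike the
one-sided freezes). [cite: KontsevichZagier2001, §1.2 Conjecture 1] -/
theorem stub_boxRigidity_var2209_iff_le_three :
    (∀ (N : IntegralRep 2) (N' : IntegralRep 3), N.domain = {x | ∀ i, x i ∈ Set.Ioo (0:ℝ) 1} → N.IsRational → N'.domain = {x | ∀ i, x i ∈ Set.Ioo (0:ℝ) 1} → N'.IsRational → N.value = N'.value → Equivalent N N') ↔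
    (∀ (m m' : ℕ) (N : IntegralRep m) (N' : IntegralRep m'), m ≤ 3 → m' ≤ 3 →
      N.domain = {x | ∀ i, x i ∈ Set.Ioo (0:ℝ) 1} → N.IsRational →
      N'.domain = {x | ∀ i, x i ∈ Set.Ioo (0:ℝ) 1} → N'.IsRational →
      N.value = N'.value → Equivalent N N') :=
  ⟨fun h => boxRigidityLe_of_boxVanishingDim 3 (stub_boxRigidity_var2209_iff_boxVanishing_three.1 h),
    fun h N N' => h 2 3 N N' (by norm_num) le_rfl⟩

/-- **V2209 ⟺ V2238** (`fix m := 3; m' ≤ 2`): two different two-sided moves of maximum `3`, one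
statement. [cite: KontsevichZagier2001, §1.2 Conjecture 1] -/
theorem stub_boxRigidity_var2209_iff_var2238 :
    (∀ (N : IntegralRep 2) (N' : IntegralRep 3), N.domain = {x | ∀ i, x i ∈ Set.Ioo (0:ℝ) 1} → N.IsRational → N'.domain = {x | ∀ i, x i ∈ Set.Ioo (0:ℝ) 1} → N'.IsRational → N.value = N'.value → Equivalent N N') ↔
    (∀ (m' : ℕ) (N : IntegralRep 3) (N' : IntegralRep m'), m' ≤ 2 → N.domain = {x | ∀ i, x i ∈ Set.Ioo (0:ℝ) 1} → N.IsRational → N'.domain = {x | ∀ i, x i ∈ Set.Ioo (0:ℝ) 1} → N'.IsRational → N.value = N'.value → Equivalent N N') :=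
  stub_boxRigidity_var2209_iff_boxVanishing_three.trans
    stub_boxRigidity_var2238_iff_boxVanishing_three.symm

/-- **V2209 ⇒ `BoxVanishing` in every dimension `≤ 3`**, in particular on the unit square (every
vanishing `ℚ`-combination of absolutely convergent `∫_{(0,1)²} p/q` is generated by the four moves —
already open: it contains `G − qπ² = 0 ⇒ relation` for every rational `q`).
[cite: KontsevichZagier2001, §1.2 Conjecture 1] -/
theorem boxVanishing_le_three_of_stub_boxRigidity_var2209
    (h : ∀ (N : IntegralRep 2) (N' : IntegralRep 3), N.domain = {x | ∀ i, x i ∈ Set.Ioo (0:ℝ) 1} → N.IsRational → N'.domain = {x | ∀ i, x i ∈ Set.Ioo (0:ℝ) 1} → N'.IsRational → N.value = N'.value → Equivalent N N')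
    {j : ℕ} (hj : j ≤ 3) (N : IntegralRep j) (hNd : N.domain = {x | ∀ i, x i ∈ Set.Ioo (0:ℝ) 1})
    (hNr : N.IsRational) (hv : N.value = 0) : of N ∈ relations :=
  boxVanishingDim_mono hj (stub_boxRigidity_var2209_iff_boxVanishing_three.1 h) N hNd hNr hv

/-- **`KontsevichZagierPeriods ⇒ V2209`**: the variant is a special case of Conjecture 1 for the
tree's calculus — so a refutation of the variant would refute the Summit.
[cite: KontsevichZagier2001, §1.2 Conjecture 1] -/
theorem stub_boxRigidity_var2209_of_statement (h : _root_.KontsevichZagierPeriods) :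
    ∀ (N : IntegralRep 2) (N' : IntegralRep 3), N.domain = {x | ∀ i, x i ∈ Set.Ioo (0:ℝ) 1} → N.IsRational → N'.domain = {x | ∀ i, x i ∈ Set.Ioo (0:ℝ) 1} → N'.IsRational → N.value = N'.value → Equivalent N N' :=
  fun N N' => (leaves_of_statement h).1 2 3 N N'

/-- **The parent leaf ⇒ V2209** (specialisation); conversely V2209 recovers the parent exactly on
dimensions `≤ 3` (`stub_boxRigidity_var2209_iff_le_three`), not beyond.
[cite: KontsevichZagier2001, §1.2 Conjecture 1] -/
theorem stub_boxRigidity_var2209_of_parent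
    (h : ∀ (m m' : ℕ) (N : IntegralRep m) (N' : IntegralRep m'), N.domain = {x | ∀ i, x i ∈ Set.Ioo (0:ℝ) 1} → N.IsRational → N'.domain = {x | ∀ i, x i ∈ Set.Ioo (0:ℝ) 1} → N'.IsRational → N.value = N'.value → Equivalent N N') :
    ∀ (N : IntegralRep 2) (N' : IntegralRep 3), N.domain = {x | ∀ i, x i ∈ Set.Ioo (0:ℝ) 1} → N.IsRational → N'.domain = {x | ∀ i, x i ∈ Set.Ioo (0:ℝ) 1} → N'.IsRational → N.value = N'.value → Equivalent N N' :=
  h 2 3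

end Summit.KontsevichZagierPeriods.KontsevichZagierPeriods.Theorems
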